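import Summits.BirchSwinnertonDyer.BirchSwinnertonDyer.Theorems.ManinLocalTwoThreeManinConstantThirty
import Summits.BirchSwinnertonDyer.BirchSwinnertonDyer.Theorems.Rank1ResidualIntModelReduction
import Summits.BirchSwinnertonDyer.BirchSwinnertonDyer.Theorems.ManinLocalTwoThreeOldformsSixty
import Literature.NumberTheory.EllipticCurves.ModularCurveEtaQuotientsProofs
import HarnessLib

/-!
# The ROOT FORM at level 30, datum-free: `F₃₀ ∈ S₂(Γ₀(30))` as a CUSP form, its analytic squeeze `Λ(F₃₀) ⊆ Λ_Néron(30a1)`,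
# and `30a1` is multiplicative at `3`

Cell bsd-f2-manin, route `ManinLocalTwoThree` (cruxes C2 `ManinOddAtFour` stmt-BirchSwinnertonDyer-22967 / C3 `ManinPrimeToThreeAtNine`
stmt-BirchSwinnertonDyer-22968), prover seat p3 gen 26; the level-`30` twin of `…RootFormFortyTwo`, input of the odd-twist ROOT-FORM
transport (`…OddTwistRootFormTransport`) at the C3 level `90 = 2·3²·5` (class `90c = 30a ⊗ χ₋₃`, the one class of level `90` WITHOUT a
weight-2 `η`-ratio presentation).

* §1 **`exists_cuspForm_thirty`** — the explicit newform combination `F₃₀ = −2·Q₀ + Q₁ + 2·Q₂` of p3 g25's `LevelThirty.f_apply_eq_thirty`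
  (three `η`-quotients of level `30`) IS a cusp form: all three quotients are CUSPIDAL (Ligozat orders `(1,1,2,2,2,2,1,1)`,
  `(1,1,3,3,1,1,1,1)`, `(1,1,1,1,3,3,1,1)` at the eight cusps; decidable `EtaCert` — `Q₀`'s is the tree's `NoNewformSixty.etaCert_b30` — + `etaQuotientCuspForm`), with its `73`-term coefficient
  table (`= aₙ(30a1)`, transported from `exists_formF_thirty`);
* §2 **`periodLattice_le_thirty`** — `Λ(F) ⊆ Λ(L₀)` for every cusp form `F` on `Γ₀(30)` with `⇑F = F₃₀` and every Néron pair `L₀` of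
  `30a1 = [1,0,1,1,2]`: the Bracket–Sturm certificate of class `30a` (`defectList_eq_thirty`, weight `12`, Sturm `72 < 73`) at FORM level;
  `exists_rootForm_thirty` packages both;
* §3 **`hasMultiplicativeReductionAtPrime_three_thirtyA1`** — `30a1` is multiplicative at `3` (`3 ∣ Δ = −2160`, `3 ∤ c₄ = −71`; kernel).

HONEST FRAMING: unconditional (standard axioms), no modularity, no CDT, no printed Manin fact, no Cremona table; nothing here proves C2,
C3 (∀ N), Manin's conjecture or BSD; items 22967/22968 stay OPEN.  No definition, no named fact, no sorry.
[cite: Ligozat1975, Ch. 3] [cite: Koehler2011, §2.1] [cite: Manin1972, Prop. 1.4] [cite: Sturm1987, Thm. 1] [cite: AgasheRibetStein2006, §§1–2]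
[cite: CremonaAlgorithms1997, §2.10 and Table 1 (30a1)] [cite: SilvermanAEC2009, VII.5 Prop. 5.1(b)]
-/

set_option autoImplicit false
-- lint-debt: the directory name repeats the summit name (sibling precedent `ManinLocalTwoThreeManinConstantThirty.lean`)
set_option linter.dupNamespace false

noncomputable section

open Complex Filter Topology Set Function
open UpperHalfPlane hiding I
open scoped Real Topology MatrixGroups ModularForm
open ModularForm CongruenceSubgroup PowerSeries
open Literature.NumberTheory.ModularForms
open Literature.NumberTheory.EllipticCurves Literature.NumberTheory.EllipticCurves.ModularForms

namespace Summit.BirchSwinnertonDyer.BirchSwinnertonDyer.Theorems.ManinLocalTwoThree.LevelThirty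

open BracketSturm
open Summit.BirchSwinnertonDyer.BirchSwinnertonDyer.Rank1Residual.IntModel

/-! ## §1 The newform combination `F₃₀` is a CUSP form of level `30` -/

-- `Q₀ = η₃η₅η₆η₁₀` is cuspidal: the tree's `NoNewformSixty.etaCert_b30` (`…OldformsSixty`), reused.

/-- `Q₁ = η₂η₃³η₅³η₃₀/(η₁η₆η₁₀η₁₅)` is a cuspidal weight-2 `η`-quotient on `Γ₀(30)` (`∏ δ^{|r_δ|} = 13500²`). [cite: Ligozat1975, Ch. 3] -/
theorem etaCert_Q1 : EtaCert 30 [(1, -1), (2, 1), (3, 3), (5, 3), (6, -1), (10, -1), (15, -1), (30, 1)] 13500 := by decide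

/-- `Q₂ = η₁η₆³η₁₀³η₁₅/(η₂η₃η₅η₃₀)` is a cuspidal weight-2 `η`-quotient on `Γ₀(30)` (`∏ δ^{|r_δ|} = 54000²`). [cite: Ligozat1975, Ch. 3] -/
theorem etaCert_Q2 : EtaCert 30 [(1, 1), (2, -1), (3, -1), (5, -1), (6, 3), (10, 3), (15, 1), (30, -1)] 54000 := by decide

/-- **THE ROOT FORM `F₃₀` AS A CUSP FORM ON `Γ₀(30)`, DATUM-FREE**: a cusp form `F` with `⇑F = −2·Q₀ + Q₁ + 2·Q₂` (the explicit newform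
combination of `LevelThirty.f_apply_eq_thirty`) and `aₙ(F) = aₙ(30a1)` for `n < 73` (kernel table).  No `X₀(30)`-datum, no modularity.
[cite: Ligozat1975, Ch. 3] [cite: Koehler2011, §2.1] [cite: CremonaAlgorithms1997, Table 1 (30a1)] -/
theorem exists_cuspForm_thirty : ∃ F : CuspForm (Gamma0 30) 2,
    ⇑F = (fun τ ↦ -2 * etaQuotient 30 (expFn [(3, 1), (5, 1), (6, 1), (10, 1)]) τ + etaQuotient 30 (expFn [(1, -1), (2, 1), (3, 3), (5, 3), (6, -1), (10, -1), (15, -1), (30, 1)]) τ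
      + 2 * etaQuotient 30 (expFn [(1, 1), (2, -1), (3, -1), (5, -1), (6, 3), (10, 3), (15, 1), (30, -1)]) τ) ∧
    ∀ n < 73, (([0, 1, -1, 1, 1, -1, -1, -4, -1, 1, 1, 0, 1, 2, 4, -1, 1, 6, -1, -4, -1, -4, 0, 0, -1, 1, -2, 1, -4, -6, 1, 8, -1, 0, -6, 4, 1, 2, 4, 2, 1, -6, 4, -4, 0, -1, 0, 0, 1, 9, -1, 6, 2, -6, -1, 0, 4, -4, 6, 0, -1, -10, -8, -4, 1, -2, 0, -4, 6, 0, -4, 0, -1].getD n 0 : ℤ) : ℂ) = cuspCoeff F n := by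
  set R0 : CuspForm (Gamma0 30) 2 := etaQuotientCuspForm 30 (expFn [(3, 1), (5, 1), (6, 1), (10, 1)]) 2 (by decide)
    (newmanCond_of_etaCert NoNewformSixty.etaCert_b30) NoNewformSixty.etaCert_b30.2.2.2.2 with hR0
  set R1 : CuspForm (Gamma0 30) 2 := etaQuotientCuspForm 30 (expFn [(1, -1), (2, 1), (3, 3), (5, 3), (6, -1), (10, -1), (15, -1), (30, 1)]) 2 (by decide)
    (newmanCond_of_etaCert etaCert_Q1) etaCert_Q1.2.2.2.2 with hR1
  set R2 : CuspForm (Gamma0 30) 2 := etaQuotientCuspForm 30 (expFn [(1, 1), (2, -1), (3, -1), (5, -1), (6, 3), (10, 3), (15, 1), (30, -1)]) 2 (by decide)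
    (newmanCond_of_etaCert etaCert_Q2) etaCert_Q2.2.2.2.2 with hR2
  have hcoe : ⇑((-2 : ℂ) • R0 + R1 + (2 : ℂ) • R2) = (fun τ ↦ -2 * etaQuotient 30 (expFn [(3, 1), (5, 1), (6, 1), (10, 1)]) τ + etaQuotient 30 (expFn [(1, -1), (2, 1), (3, 3), (5, 3), (6, -1), (10, -1), (15, -1), (30, 1)]) τ
      + 2 * etaQuotient 30 (expFn [(1, 1), (2, -1), (3, -1), (5, -1), (6, 3), (10, 3), (15, 1), (30, -1)]) τ) := by
    funext τ
    simp only [CuspForm.add_apply, CuspForm.IsGLPos.smul_apply, smul_eq_mul, hR0, hR1, hR2, coe_etaQuotientCuspForm]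
  obtain ⟨Fm, hFt, hFcoe⟩ := exists_formF_thirty
  exact ⟨(-2 : ℂ) • R0 + R1 + (2 : ℂ) • R2, hcoe, coeff_eq_of_coe_eq (hcoe.trans hFcoe.symm) hFt⟩

/-! ## §2 The analytic squeeze of the root form: `Λ(F₃₀) ⊆ Λ_Néron(30a1)` -/

/-- **`Λ(F) ⊆ Λ(L₀)` for every cusp form `F` on `Γ₀(30)` with `⇑F = F₃₀` and every Néron pair `L₀` of `30a1 = [1, 0, 1, 1, 2]`** — the
Bracket–Sturm certificate of class `30a` at FORM level (weight-12 defect `≡ 0 (mod q^73)`, Sturm `72 < 73`).  No datum, no modularity.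
[cite: Manin1972, Prop. 1.4] [cite: Sturm1987, Thm. 1] [cite: CremonaAlgorithms1997, §2.10] -/
theorem periodLattice_le_thirty (F : CuspForm (Gamma0 30) 2)
    (hF : ⇑F = (fun τ ↦ -2 * etaQuotient 30 (expFn [(3, 1), (5, 1), (6, 1), (10, 1)]) τ + etaQuotient 30 (expFn [(1, -1), (2, 1), (3, 3), (5, 3), (6, -1), (10, -1), (15, -1), (30, 1)]) τ
      + 2 * etaQuotient 30 (expFn [(1, 1), (2, -1), (3, -1), (5, -1), (6, 3), (10, 3), (15, 1), (30, -1)]) τ))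
    (L₀ : PeriodPair) (hL₀ : IsNeronLatticeOf ((⟨1, 0, 1, 1, 2⟩ : WeierstrassCurve ℚ).baseChange ℂ) L₀) :
    ∀ z ∈ periodLattice F, z ∈ L₀.lattice := by
  obtain ⟨A, B, hA, hB⟩ := exists_formsAB_thirty
  obtain ⟨Fm, hFt, hFcoe⟩ := exists_formF_thirty
  have hc := coeff_eq_of_coe_eq (hF.trans hFcoe.symm) hFt
  have hFne : F ≠ 0 := by
    intro h0
    have h1 := hc 1 (by norm_num)
    rw [h0, CuspForm.coe_zero, UpperHalfPlane.qExpansion_zero, map_zero] at h1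
    norm_num at h1
  obtain ⟨hc₂, hc₃⟩ := neron_invariants_thirtyA1 hL₀
  obtain ⟨h0, hBne, hCne⟩ := defectForm_coeff_eq_zero_of_defectList A B F L₀.g₂ L₀.g₃ _ _ _ hA hB hc 216 864 (-1278) (-1837)
    (by norm_num) (by norm_num) hc₂ hc₃ (forall_getD_eq_zero_of_eq_replicate defectList_eq_thirty) hBnz_thirty hCnz_thirty
  exact periodLattice_le_of_defectForm_eq_zero F hFne L₀ A B (modularForm_eq_zero_of_coeff_eq_zero _ h0 sturm_thirty) hBne hCne

/-- **Packaged datum-free root squeeze at level `30`**: a cusp form `F` on `Γ₀(30)` with `aₙ(F) = aₙ(30a1)` (`n < 73`) whose period lattice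
lies in every Néron lattice of `30a1`. [cite: Manin1972, Prop. 1.4] [cite: AgasheRibetStein2006, §§1–2] -/
theorem exists_rootForm_thirty : ∃ F : CuspForm (Gamma0 30) 2,
    (∀ n < 73, (([0, 1, -1, 1, 1, -1, -1, -4, -1, 1, 1, 0, 1, 2, 4, -1, 1, 6, -1, -4, -1, -4, 0, 0, -1, 1, -2, 1, -4, -6, 1, 8, -1, 0, -6, 4, 1, 2, 4, 2, 1, -6, 4, -4, 0, -1, 0, 0, 1, 9, -1, 6, 2, -6, -1, 0, 4, -4, 6, 0, -1, -10, -8, -4, 1, -2, 0, -4, 6, 0, -4, 0, -1].getD n 0 : ℤ) : ℂ) = cuspCoeff F n) ∧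
    ∀ (L₀ : PeriodPair), IsNeronLatticeOf ((⟨1, 0, 1, 1, 2⟩ : WeierstrassCurve ℚ).baseChange ℂ) L₀ →
      ∀ z ∈ periodLattice F, z ∈ L₀.lattice := by
  obtain ⟨F, hF, ht⟩ := exists_cuspForm_thirty
  exact ⟨F, ht, fun L₀ hL₀ ↦ periodLattice_le_thirty F hF L₀ hL₀⟩

/-! ## §3 `30a1` is multiplicative at `3` -/

/-- The tree's integral model of `30a1` is `[1, 0, 1, 1, 2]`. [folklore] -/
theorem integralModelInt_thirtyA1 [(⟨1, 0, 1, 1, 2⟩ : WeierstrassCurve ℚ).IsGloballyMinimal] :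
    WeierstrassCurve.integralModelInt (⟨1, 0, 1, 1, 2⟩ : WeierstrassCurve ℚ) = ⟨1, 0, 1, 1, 2⟩ :=
  integralModelInt_eq_of_map_eq _ ((map_mk_int 1 0 1 1 2).trans mk_thirtyA1_eq_cast.symm)

/-- **`30a1` has multiplicative reduction at `3`** (`3 ∣ Δ = −2160`, `3 ∤ c₄ = −71`). [cite: SilvermanAEC2009, VII.5 Prop. 5.1(b)]
[cite: CremonaAlgorithms1997, Table 1 (30a1)] -/
theorem hasMultiplicativeReductionAtPrime_three_thirtyA1 [Fact (Nat.Prime 3)] :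
    (⟨1, 0, 1, 1, 2⟩ : WeierstrassCurve ℚ).HasMultiplicativeReductionAtPrime 3 := by
  haveI := Rank1Residual.X2.RouteGSplitDisplay210930v1Local.isElliptic_30a1
  haveI := Rank1Residual.X2.RouteGSplitDisplay210930v1Local.isGloballyMinimal_30a1
  exact hasMultiplicativeReductionAtPrime_of_intModel (W := (⟨1, 0, 1, 1, 2⟩ : WeierstrassCurve ℚ))
    integralModelInt_thirtyA1 3 (by decide) (by decide)

end Summit.BirchSwinnertonDyer.BirchSwinnertonDyer.Theorems.ManinLocalTwoThree.LevelThirty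

end
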